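import Mathlib
import Literature.AlgebraicGeometry.Resolution.AugmentationIdeal
import Summits.ResolutionOfSingularities.ResolutionOfSingularities.Theorems.WildQuotientsWildQuotientResolutionFixedPointsRegular

/-!
# Involutions with `2` invertible: anti-invariant augmentation, the terminal Rees chart, K–L at the prime `2`

(crux stmt-ResolutionOfSingularities-15640 `WildQuotients.WildQuotientResolution`, line `Sketch`,
sector `|G| = p`; RUNG V5 of `L/w45c/CHAIN.md` v8.1, brick B7/`HP₂` (the `μ₂`-HIGH exit of `J₅`),
route = res-L1-w45c-idea-2's card `mu2-strata-kl-twice` («Király–Lütkebohmert used twice»),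
res-L1-w45c-plan-1 RULING 2026-08-27T11:12Z «(γ) GENERIC INVOLUTION PACKAGE … H1/H4/H5 = 036 GO
NOW … keep it W₂-independent and def-free»; statements = the def-free forms of
`Sketch-L1-idea-2.lean` v4/v7 §Card H `InvolutionAugIdealEqAnti` (H1), `InvolutionChartTerminal`
(H4), `KLAtTwo` (H5). [OURS · L1 W4.5c] — NOT a statement of any manuscript; replaces the role of no
printed item. Prover res-type-036. Def-free; the augmentation ideal is the Literature
`augIdeal ι = Ideal.span (range (ι b − b))` of [cite: KiralyLutkebohmert2013, §1].)

Setting: `R` a commutative ring, `ι : R ≃+* R` an involution (`ι (ι x) = x`), `2 ∈ R×`;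
`I_ι := augIdeal ι`; `R₋ := {y | ι y = −y}` the anti-invariants.

* `augIdeal_eq_span_anti` (H1): `I_ι = (R₋)` — `ι b − b` is anti-invariant, and an anti-invariant
  `y` is `−½ (ι y − y)`.
* `apply_add_self_mem_sq`: for `b ∈ I_ι`, `ι b + b ∈ I_ι²` (the parity fact behind H3/H4).
* `involutionChartTerminal` (H4): for `y` anti-invariant (no domain hypothesis needed), on the Rees chart
  `C = R[I_ι/y] ⊆ R[1/y]` (the `R`-subalgebra of `Localization.Away y` generated by the quotients
  `b/y`, `b ∈ I_ι`) the involution extends to `ιC : C ≃+* C` over `ι`, and ITS augmentation ideal is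
  `(y)·C` — the lifted involution is Király–Lütkebohmert TERMINAL on every chart of `Bl_{I_ι}`.
* `isRegularRing_fixedPoints_of_involution` (H5, K–L at the prime `2`): a regular domain `U` of
  finite type over a field with an involution `ι ≠ 1` whose augmentation ideal is principal has
  regular invariants — ONE application of `TameTransfer.isRegularRing_fixedPoints_zpowers` (p460154)
  at `p := 2` (that theorem has no `CharP` hypothesis).
H2 (`Fix ι` regular) and H3 (Rees parity) are res-L1-w45c-stub-3's files (same RULING).
-/

-- single-problem summit: the doubled namespace component `ResolutionOfSingularities` is forced
set_option linter.dupNamespace false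

noncomputable section

namespace Summit.ResolutionOfSingularities.ResolutionOfSingularities.Theorems.WildQuotientResolution.InvolutionExit

open Literature.AlgebraicGeometry.Resolution (augIdeal sub_mem_augIdeal apply_mem_augIdeal_of_mem)

section H1

variable {R : Type*} [CommRing R] (ι : R ≃+* R) (hι : ∀ x, ι (ι x) = x)

include hι in
/-- The generators `ι b − b` of the augmentation ideal of an involution are anti-invariant.
[folklore] -/
theorem apply_sub_self_anti (b : R) : ι (ι b - b) = -(ι b - b) := by
  rw [map_sub, hι]
  ring

include hι in
/-- **H1.** For an involution `ι` with `2` invertible, the augmentation ideal is the ideal generated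
by the anti-invariant elements: `I_ι = (y : ι y = −y)`. [OURS · L1 W4.5c, card `mu2-strata-kl-twice`
H1] [folklore] -/
theorem augIdeal_eq_span_anti (h2 : IsUnit (2 : R)) :
    augIdeal ι = Ideal.span {y : R | ι y = -y} := by
  apply le_antisymm
  · refine Ideal.span_le.2 ?_
    rintro _ ⟨b, rfl⟩
    exact Ideal.subset_span (apply_sub_self_anti ι hι b)
  · refine Ideal.span_le.2 fun y hy => ?_
    obtain ⟨u, hu⟩ := h2
    have e : (-(↑u⁻¹ : R)) * (ι y - y) = y := by
      rw [show ι y = -y from hy, show (-y - y : R) = -(2 * y) by ring, ← hu, mul_neg, neg_mul,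
        neg_neg, ← mul_assoc, Units.inv_mul, one_mul]
    rw [SetLike.mem_coe, ← e]
    exact Ideal.mul_mem_left _ _ (sub_mem_augIdeal ι y)

include hι in
/-- An anti-invariant element lies in the augmentation ideal (`2` invertible). [folklore] -/
theorem mem_augIdeal_of_anti (h2 : IsUnit (2 : R)) {y : R} (hy : ι y = -y) : y ∈ augIdeal ι := by
  rw [augIdeal_eq_span_anti ι hι h2]
  exact Ideal.subset_span hy

include hι in
/-- **Parity.** For `b` in the augmentation ideal of an involution (`2` invertible),
`ι b + b ∈ I_ι²`: writing `b = Σ rᵢ aᵢ` with `aᵢ` anti-invariant,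
`ι b + b = Σ (ι rᵢ − rᵢ)·(−aᵢ) ∈ I_ι · I_ι`. [OURS · L1 W4.5c] [folklore] -/
theorem apply_add_self_mem_sq (h2 : IsUnit (2 : R)) {b : R} (hb : b ∈ augIdeal ι) :
    ι b + b ∈ augIdeal ι ^ 2 := by
  rw [augIdeal_eq_span_anti ι hι h2] at hb
  induction hb using Submodule.span_induction with
  | mem a ha =>
    rw [show ι a = -a from ha, neg_add_cancel]
    exact zero_mem _
  | zero =>
    rw [map_zero, add_zero]
    exact zero_mem _
  | add x z _ _ hx hz =>
    rw [map_add, show ι x + ι z + (x + z) = (ι x + x) + (ι z + z) by ring]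
    exact add_mem hx hz
  | smul r x hx ih =>
    have hxI : x ∈ augIdeal ι := by rwa [augIdeal_eq_span_anti ι hι h2]
    rw [smul_eq_mul, map_mul,
      show ι r * ι x + r * x = ι r * (ι x + x) - (ι r - r) * x by ring]
    refine sub_mem (Ideal.mul_mem_left _ _ ih) ?_
    rw [pow_two]
    exact Ideal.mul_mem_mul (sub_mem_augIdeal ι r) hxI

end H1

section H5

/-- **H5 — Király–Lütkebohmert at the prime `2`.** A regular domain `U` of finite type over a field
`k` carrying a `k`-algebra involution `ι ≠ 1` whose augmentation ideal `(ι u − u : u)` is principal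
has a regular ring of invariants `U^⟨ι⟩`. This is `TameTransfer.isRegularRing_fixedPoints_zpowers`
(p460154) at `p := 2`: at every `ι`-fixed prime the image of a principal ideal is principal.
[OURS · L1 W4.5c, card `mu2-strata-kl-twice` H5] [cite: KiralyLutkebohmert2013, Thm 2] -/
theorem isRegularRing_fixedPoints_of_involution {k U : Type} [Field k] [CommRing U] [IsDomain U]
    [IsRegularRing U] [Algebra k U] [Algebra.FiniteType k U] (ι : U ≃ₐ[k] U) (hι1 : ι ≠ 1)
    (hι2 : ι ^ 2 = 1) (hprinc : (Ideal.span (Set.range fun u : U => ι u - u)).IsPrincipal) :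
    IsRegularRing (FixedPoints.subalgebra k U (Subgroup.zpowers ι)) := by
  refine TameTransfer.isRegularRing_fixedPoints_zpowers Nat.prime_two ι hι1 hι2 fun 𝔮 _ _ => ?_
  obtain ⟨a, ha⟩ := hprinc
  refine ⟨⟨algebraMap U (Localization.AtPrime 𝔮) a, ?_⟩⟩
  rw [ha, Ideal.submodule_span_eq, Ideal.map_span, Set.image_singleton, Ideal.submodule_span_eq]

end H5

section H4

variable {R : Type*} [CommRing R] (ι : R ≃+* R) (hι : ∀ x, ι (ι x) = x)
  (h2 : IsUnit (2 : R)) (y : R) (hy : ι y = -y)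

include hy in
/-- The involution extends to `R[1/y]` for `y` anti-invariant (`ι y = −y` is a unit multiple of `y`):
`ι' (r / yⁿ) = ι r / (−y)ⁿ`. [folklore] -/
theorem isUnit_algebraMap_comp_apply :
    IsUnit (((algebraMap R (Localization.Away y)).comp (ι : R →+* R)) y) := by
  rw [RingHom.comp_apply, RingHom.coe_coe, hy, map_neg]
  exact (IsLocalization.Away.algebraMap_isUnit y).neg

include hι in
/-- The extension `ι'` of `ι` to `R[1/y]` is again an involution. [folklore] -/
theorem awayLift_awayLift (q : Localization.Away y) :
    IsLocalization.Away.lift (S := Localization.Away y) y (isUnit_algebraMap_comp_apply ι y hy)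
      (IsLocalization.Away.lift (S := Localization.Away y) y (isUnit_algebraMap_comp_apply ι y hy) q) = q := by
  set ι' := IsLocalization.Away.lift (S := Localization.Away y) y (isUnit_algebraMap_comp_apply ι y hy) with hι'
  have key : ι'.comp ι' = RingHom.id (Localization.Away y) := by
    refine IsLocalization.ringHom_ext (Submonoid.powers y) ?_
    ext r
    simp only [RingHom.comp_apply, RingHom.id_apply, hι', IsLocalization.Away.lift_eq,
      RingHom.coe_coe, hι]
  exact congrArg (fun φ : Localization.Away y →+* Localization.Away y => φ q) key

/-- The extension `ι'` maps the Rees chart `R[I_ι/y]` into itself: if `q·y = b` with `b ∈ I_ι` then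
`ι'(q)·y = −ι b` and `−ι b ∈ I_ι`. [OURS · L1 W4.5c] [folklore] -/
theorem awayLift_mem_reesChart (q : Localization.Away y)
    (hq : q ∈ Algebra.adjoin R {q : Localization.Away y | ∃ b ∈ augIdeal ι,
      q * algebraMap R (Localization.Away y) y = algebraMap R (Localization.Away y) b}) :
    IsLocalization.Away.lift (S := Localization.Away y) y (isUnit_algebraMap_comp_apply ι y hy) q ∈
      Algebra.adjoin R {q : Localization.Away y | ∃ b ∈ augIdeal ι,
        q * algebraMap R (Localization.Away y) y = algebraMap R (Localization.Away y) b} := by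
  set L := Localization.Away y
  set ι' := IsLocalization.Away.lift (S := Localization.Away y) y (isUnit_algebraMap_comp_apply ι y hy) with hι'
  have hι'alg : ∀ r : R, ι' (algebraMap R L r) = algebraMap R L (ι r) := fun r => by
    rw [hι', IsLocalization.Away.lift_eq, RingHom.comp_apply, RingHom.coe_coe]
  induction hq using Algebra.adjoin_induction with
  | mem q hq =>
    obtain ⟨b, hb, hqb⟩ := hq
    refine Algebra.subset_adjoin ⟨-ι b, ?_, ?_⟩
    · exact Submodule.neg_mem _ (apply_mem_augIdeal_of_mem ι hb)
    · have h := congrArg ι' hqb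
      rw [map_mul, hι'alg, hι'alg, hy, map_neg] at h
      rw [map_neg, ← h]
      ring
  | algebraMap r =>
    rw [hι'alg]
    exact Subalgebra.algebraMap_mem _ _
  | add q₁ q₂ _ _ h₁ h₂ =>
    rw [map_add]
    exact add_mem h₁ h₂
  | mul q₁ q₂ _ _ h₁ h₂ =>
    rw [map_mul]
    exact mul_mem h₁ h₂

/-- Quotients of squares: `b₁ b₂ / y²` lies in the Rees chart `R[I_ι/y]` for `b₁, b₂ ∈ I_ι`, hence
so does `c / y²` for every `c ∈ I_ι²`. [folklore] -/
theorem exists_mem_reesChart_of_mem_sq {c : R} (hc : c ∈ augIdeal ι ^ 2) :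
    ∃ w ∈ Algebra.adjoin R {q : Localization.Away y | ∃ b ∈ augIdeal ι,
        q * algebraMap R (Localization.Away y) y = algebraMap R (Localization.Away y) b},
      w * algebraMap R (Localization.Away y) y ^ 2 = algebraMap R (Localization.Away y) c := by
  set L := Localization.Away y
  set S : Set L := {q : L | ∃ b ∈ augIdeal ι, q * algebraMap R L y = algebraMap R L b} with hS
  obtain ⟨uy, huy⟩ := IsLocalization.Away.algebraMap_isUnit (S := L) y
  rw [pow_two] at hc
  refine Submodule.mul_induction_on hc (fun b₁ hb₁ b₂ hb₂ => ?_) (fun c₁ c₂ h₁ h₂ => ?_)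
  · refine ⟨(algebraMap R L b₁ * ↑uy⁻¹) * (algebraMap R L b₂ * ↑uy⁻¹),
      mul_mem (Algebra.subset_adjoin ⟨b₁, hb₁, ?_⟩) (Algebra.subset_adjoin ⟨b₂, hb₂, ?_⟩), ?_⟩
    · rw [← huy, mul_assoc, Units.inv_mul, mul_one]
    · rw [← huy, mul_assoc, Units.inv_mul, mul_one]
    · rw [map_mul, ← huy, pow_two]
      calc algebraMap R L b₁ * ↑uy⁻¹ * (algebraMap R L b₂ * ↑uy⁻¹) * (↑uy * ↑uy)
          = algebraMap R L b₁ * algebraMap R L b₂ * (↑uy⁻¹ * ↑uy) * (↑uy⁻¹ * ↑uy) := by ring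
        _ = algebraMap R L b₁ * algebraMap R L b₂ := by rw [Units.inv_mul, mul_one, mul_one]
  · obtain ⟨w₁, hw₁, e₁⟩ := h₁
    obtain ⟨w₂, hw₂, e₂⟩ := h₂
    exact ⟨w₁ + w₂, add_mem hw₁ hw₂, by rw [add_mul, e₁, e₂, map_add]⟩

include hι h2 hy in
/-- **H4 — the lifted involution is Király–Lütkebohmert terminal on the Rees chart.** For an
involution `ι` with `2` invertible and `y` anti-invariant (any commutative ring; for the blow-up one
takes `R` a domain and `y ≠ 0`), on the Rees chart
`C = R[I_ι/y] ⊆ R[1/y]` (`I_ι = augIdeal ι`) there is a ring involution `ιC` extending `ι`, and its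
augmentation ideal `(ιC c − c : c ∈ C)` is the principal ideal `(y)·C`: for `q = b/y` (`b ∈ I_ι`),
`ιC q − q = −(ι b + b)/y ∈ y·(I_ι²/y²) ⊆ y·C` (`apply_add_self_mem_sq`), and `y = −½(ιC y − y)`.
[OURS · L1 W4.5c, card `mu2-strata-kl-twice` H4] -/
theorem involutionChartTerminal :
    ∃ ιC : Algebra.adjoin R {q : Localization.Away y | ∃ b ∈ augIdeal ι,
        q * algebraMap R (Localization.Away y) y = algebraMap R (Localization.Away y) b} ≃+*
      Algebra.adjoin R {q : Localization.Away y | ∃ b ∈ augIdeal ι,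
        q * algebraMap R (Localization.Away y) y = algebraMap R (Localization.Away y) b},
      (∀ c, ιC (ιC c) = c) ∧
      (∀ r : R, ((ιC (algebraMap R _ r) : Algebra.adjoin R {q : Localization.Away y |
          ∃ b ∈ augIdeal ι, q * algebraMap R (Localization.Away y) y =
            algebraMap R (Localization.Away y) b}) : Localization.Away y) =
        algebraMap R (Localization.Away y) (ι r)) ∧
      Ideal.span (Set.range fun c => ιC c - c) =
        Ideal.span {algebraMap R (Algebra.adjoin R {q : Localization.Away y | ∃ b ∈ augIdeal ι,
          q * algebraMap R (Localization.Away y) y = algebraMap R (Localization.Away y) b}) y} := by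
  classical
  set L := Localization.Away y
  set S : Set L := {q : L | ∃ b ∈ augIdeal ι, q * algebraMap R L y = algebraMap R L b} with hS
  set C : Subalgebra R L := Algebra.adjoin R S with hC
  set ι' : L →+* L := IsLocalization.Away.lift (S := Localization.Away y) y (isUnit_algebraMap_comp_apply ι y hy) with hι'
  have hι'alg : ∀ r : R, ι' (algebraMap R L r) = algebraMap R L (ι r) := fun r => by
    rw [hι', IsLocalization.Away.lift_eq, RingHom.comp_apply, RingHom.coe_coe]
  have hι'ι' : ∀ q, ι' (ι' q) = q := awayLift_awayLift ι hι y hy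
  have hmaps : ∀ q ∈ C, ι' q ∈ C := fun q hq => awayLift_mem_reesChart ι y hy q hq
  -- the restriction and its inverse
  set ιC₀ : C →+* C := ι'.restrict C C hmaps with hιC₀
  have hιC₀val : ∀ c : C, ((ιC₀ c : C) : L) = ι' c := fun c => rfl
  have hcomp : ιC₀.comp ιC₀ = RingHom.id C := by
    ext c
    change ((ιC₀ (ιC₀ c) : C) : L) = (c : L)
    rw [hιC₀val, hιC₀val, hι'ι']
  let ιC : C ≃+* C := RingEquiv.ofRingHom ιC₀ ιC₀ hcomp hcomp
  have hιCval : ∀ c : C, ((ιC c : C) : L) = ι' c := fun c => rfl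
  have hιCι : ∀ c, ιC (ιC c) = c := fun c =>
    congrArg (fun φ : C →+* C => φ c) hcomp
  refine ⟨ιC, hιCι, fun r => ?_, ?_⟩
  · rw [hιCval, Subalgebra.coe_algebraMap, hι'alg]
  -- the augmentation ideal of `ιC` is `(y)`
  obtain ⟨uy, huy⟩ := IsLocalization.Away.algebraMap_isUnit (S := L) y
  set yC : C := algebraMap R C y with hyC
  have hyCval : (yC : L) = algebraMap R L y := rfl
  apply le_antisymm
  · -- `⊆`: every `ιC c − c` is a multiple of `y`
    refine Ideal.span_le.2 ?_
    rintro _ ⟨c, rfl⟩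
    rw [SetLike.mem_coe, Ideal.mem_span_singleton']
    -- induction over the generation of `C`, for the element `(c : L)`
    suffices h : ∀ (x : L) (hx : x ∈ C), ∃ a : C, a * yC = ιC ⟨x, hx⟩ - ⟨x, hx⟩ from h c c.2
    intro x hx
    induction hx using Algebra.adjoin_induction with
    | mem q hq =>
      obtain ⟨b, hb, hqb⟩ := hq
      -- `ιC q − q = −(ι b + b)/y = −y · ((ι b + b)/y²)`
      obtain ⟨w, hw, hwy⟩ := exists_mem_reesChart_of_mem_sq ι y (apply_add_self_mem_sq ι hι h2 hb)
      refine ⟨-⟨w, hw⟩, Subtype.ext ?_⟩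
      change -w * (yC : L) = ι' q - q
      -- compare after multiplying by the unit `y`
      have hq' : q = algebraMap R L b * ↑uy⁻¹ := by
        rw [← hqb, ← huy, mul_assoc, Units.mul_inv, mul_one]
      have hιq : ι' q = algebraMap R L (ι b) * (-↑uy⁻¹) := by
        rw [hq', map_mul, hι'alg]
        congr 1
        -- `ι' (y⁻¹) = (ι y)⁻¹ = (−y)⁻¹`
        have h1 : ι' (↑uy⁻¹ : L) * ι' (↑uy : L) = 1 := by
          rw [← map_mul, Units.inv_mul, map_one]
        rw [huy, hι'alg, hy, map_neg, ← huy] at h1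
        -- h1 : ι' ↑uy⁻¹ * -↑uy = 1
        calc ι' (↑uy⁻¹ : L) = ι' (↑uy⁻¹ : L) * (-↑uy * -↑uy⁻¹) := by
              rw [neg_mul_neg, Units.mul_inv, mul_one]
          _ = (ι' (↑uy⁻¹ : L) * -↑uy) * -↑uy⁻¹ := by ring
          _ = -↑uy⁻¹ := by rw [h1, one_mul]
      rw [hιq, hq', hyCval, ← huy]
      -- goal: -w * ↑uy = algebraMap (ι b) * -↑uy⁻¹ - algebraMap b * ↑uy⁻¹, with w * ↑uy² = alg (ι b + b)
      have hwy' : w = algebraMap R L (ι b + b) * ↑uy⁻¹ * ↑uy⁻¹ := by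
        rw [← hwy, ← huy]
        calc w = w * (↑uy * ↑uy⁻¹) * (↑uy * ↑uy⁻¹) := by rw [Units.mul_inv, mul_one, mul_one]
          _ = w * ↑uy ^ 2 * ↑uy⁻¹ * ↑uy⁻¹ := by ring
      rw [hwy', map_add]
      calc -(( algebraMap R L (ι b) + algebraMap R L b) * ↑uy⁻¹ * ↑uy⁻¹) * ↑uy
          = -(algebraMap R L (ι b) + algebraMap R L b) * ↑uy⁻¹ * (↑uy⁻¹ * ↑uy) := by ring
        _ = algebraMap R L (ι b) * -↑uy⁻¹ - algebraMap R L b * ↑uy⁻¹ := by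
          rw [Units.inv_mul, mul_one]; ring
    | algebraMap r =>
      -- `ιC r − r = (ι r − r) = y · ((ι r − r)/y)` and `(ι r − r)/y ∈ C`
      refine ⟨⟨algebraMap R L (ι r - r) * ↑uy⁻¹, Algebra.subset_adjoin ⟨ι r - r,
        sub_mem_augIdeal ι r, by rw [← huy, mul_assoc, Units.inv_mul, mul_one]⟩⟩, Subtype.ext ?_⟩
      change algebraMap R L (ι r - r) * ↑uy⁻¹ * (yC : L) =
        ι' (algebraMap R L r) - algebraMap R L r
      rw [hyCval, ← huy, mul_assoc, Units.inv_mul, mul_one, hι'alg, map_sub]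
    | add x z hx hz h₁ h₂ =>
      obtain ⟨a₁, e₁⟩ := h₁
      obtain ⟨a₂, e₂⟩ := h₂
      refine ⟨a₁ + a₂, ?_⟩
      have e : (⟨x + z, add_mem hx hz⟩ : C) = ⟨x, hx⟩ + ⟨z, hz⟩ := rfl
      rw [e, map_add, add_mul, e₁, e₂]
      ring
    | mul x z hx hz h₁ h₂ =>
      obtain ⟨a₁, e₁⟩ := h₁
      obtain ⟨a₂, e₂⟩ := h₂
      refine ⟨a₁ * ιC ⟨z, hz⟩ + ⟨x, hx⟩ * a₂, ?_⟩
      have e : (⟨x * z, mul_mem hx hz⟩ : C) = ⟨x, hx⟩ * ⟨z, hz⟩ := rfl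
      rw [e, map_mul, add_mul, mul_right_comm, e₁, mul_assoc, e₂]
      ring
  · -- `⊇`: `y = −½ (ιC y − y)`
    rw [Ideal.span_singleton_le_iff_mem]
    obtain ⟨u2, hu2⟩ := h2.map (algebraMap R C)
    have hιy : ιC yC = -yC := Subtype.ext (by
      rw [hιCval, hyC, Subalgebra.coe_algebraMap, hι'alg, hy, map_neg]; rfl)
    have h2y : -(ιC yC - yC) = ↑u2 * yC := by
      rw [hιy, hu2, map_ofNat]
      ring
    have e : (↑u2⁻¹ : C) * -(ιC yC - yC) = yC := by
      rw [h2y, Units.inv_mul_cancel_left]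
    rw [← e]
    exact Ideal.mul_mem_left _ _ (Submodule.neg_mem _ (Ideal.subset_span ⟨yC, rfl⟩))

end H4

end Summit.ResolutionOfSingularities.ResolutionOfSingularities.Theorems.WildQuotientResolution.InvolutionExit

end
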